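import Summits.Ventures.HSemireg.WedgeHankelRecurrenceGaussChebyshevResultantClosedRing

/-!
# Venture HSemireg — **THE RESULTANT OF TWO VIETA–FIBONACCI POLYNOMIALS IS `0` OR `±1` OVER EVERY COMMUTATIVE RING: `Res_{(m,n)}(S_m, S_n) = (−1)^{mn∕2}` IF `gcd(m+1,n+1) = 1`, `= 0`
# OTHERWISE** (Mathlib's monic `S_n(x) = U_n(x∕2)`): the Euclidean step for resultants `Res_{(m,n+m+1)}(S_m, S_{n+m+1}) = (−1)^{m(m+1)∕2} Res_{(m,n)}(S_m, S_n)` (addition formula N465,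
# `Res(f, g + f p) = Res(f, g)`, multiplicativity, and SCHUR's consecutive value N403 for the monic recurrence with `a_k = 0`, `b_k = 1`), then the descent of N460 — the unimodular shadow of
# `|Res(U_m, U_n)| = 2^{mn}` (all the powers of `2` there are leading coefficients)

HONEST FRAMING. Part of the Lean index of the computation cell `pub-hsemireg` (seat p10 gen 48, Sunday typer «UNIFORM-IN-n»).  Polynomial ∕ resultant algebra and `ℕ`-parity bookkeeping only; no
variety, no cohomology theory, no sheaf, no Ext group and no semiregularity map is constructed here; nothing here says that HC / HC_CM / HC_AV holds; no Literature fact (unproved `Prop`) is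
declared or used.  Custodian versions as in `WedgeHankelSiegelIdeal` (1/3).
SOURCES (cited).  K. Dilcher, K. B. Stolarsky, Trans. Amer. Math. Soc. 357 (2005) 965–981, Thm 3.1 (the `U`-form; the monic rescaling removes the power of `2`); I. Schur, *Affektlose Gleichungen in der
Theorie der Laguerreschen und Hermiteschen Polynome*, J. Reine Angew. Math. 165 (1931) 52–58, §2 (resultant of consecutive terms of a three-term recurrence); V. E. Hoggatt Jr., C. T. Long, Fibonacci
Quart. 12 (1974) 113–120.
PROOF TYPED HERE.  N465 `chebyshevS_add`, `chebyshevS_natDegree_monic`; N403 `schur_resultant_sign`; N460 `even_mul_of_coprime_succ`; Mathlib `resultant_add_mul_right`, `resultant_mul_right`,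
`resultant_comm`, `resultant_self_eq_zero`, `resultant_one_left`, `S_add_two`, `S_neg_one`, `Nat.coprime_add_self_right`, `Nat.strong_induction_on`.
DEDUP DISCLOSURE (`rg -n 'chebyshevS_natDegree_pred_le|chebyshevS_resultant' Summits Literature HarnessLib`, 2026-09-04): 0 hits for the 5 names below.

WHAT IS IN THE TREE.  N403, N460, N465.
THIS FILE (namespace `Summit.Ventures.HSemireg.Wedge.HankelOuter` continued; CHAINED on N467; 0 definitions):
* §1233 `chebyshevS_natDegree_pred_le`, **`chebyshevS_resultant_succ`** (Schur: `Res_{(n+1,n)}(S_{n+1}, S_n) = (−1)^{n(n+1)∕2}`), **`chebyshevS_resultant_add_succ`** (Euclidean step),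
  `chebyshevS_resultant_closed_step`, **`chebyshevS_resultant_closed`**.
CAVEATS.  `mn ∕ 2` is `ℕ`-division (exact whenever the resultant is non-zero).  Formal degrees explicit.  Nothing Ext-side.  New names only.
-/

open Module Polynomial
open scoped Matrix Polynomial

namespace Summit.Ventures.HSemireg.Wedge.HankelOuter

/-! ## §1233. `Res(S_m, S_n) ∈ {0, ±1}` in closed form -/

/-- `deg S_{n−1} ≤ n` for `n ∈ ℕ` (`S_{−1} = 0`; nontrivial ring). [bookkeeping; this file, §1233] -/
theorem chebyshevS_natDegree_pred_le {R : Type*} [CommRing R] [Nontrivial R] (n : ℕ) : (Polynomial.Chebyshev.S R ((n : ℤ) - 1)).natDegree ≤ n := by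
  rcases n with _ | k
  · rw [Nat.cast_zero, zero_sub, Polynomial.Chebyshev.S_neg_one, natDegree_zero]
  · rw [show (((k + 1 : ℕ)) : ℤ) - 1 = (k : ℤ) by push_cast; ring, (chebyshevS_natDegree_monic (R := R) k).1]; omega

/-- **SCHUR for `S`: `Res_{(n+1,n)}(S_{n+1}, S_n) = (−1)^{n(n+1)∕2}`** (every commutative ring; the recurrence `S_{k+2} = X S_{k+1} − S_k` has `a_k = 0`, `b_k = 1`). [Schur 1931 §2, via N403; this file, §1233] -/
theorem chebyshevS_resultant_succ {R : Type*} [CommRing R] (n : ℕ) :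
    (Polynomial.Chebyshev.S R (((n + 1 : ℕ)) : ℤ)).resultant (Polynomial.Chebyshev.S R (n : ℤ)) (n + 1) n = (-1) ^ (n * (n + 1) / 2) := by
  have h := schur_resultant_sign (q := fun k : ℕ => Polynomial.Chebyshev.S R (k : ℤ)) (a := fun _ => (0 : R)) (b := fun _ => (1 : R))
    (by simp only [Nat.cast_zero, Polynomial.Chebyshev.S_zero]) (by simp only [Nat.cast_one, Polynomial.Chebyshev.S_one, map_zero, sub_zero])
    (fun k => by
      simp only [Nat.cast_add, Nat.cast_ofNat, Nat.cast_one, map_zero, sub_zero, map_one, one_mul]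
      exact Polynomial.Chebyshev.S_add_two R (k : ℤ)) n
  simp only [one_pow, Finset.prod_const_one, mul_one] at h
  exact h

/-- **EUCLIDEAN STEP: `Res_{(m, n+m+1)}(S_m, S_{n+m+1}) = (−1)^{m(m+1)∕2} · Res_{(m,n)}(S_m, S_n)`** (every commutative ring). [this file, §1233] -/
theorem chebyshevS_resultant_add_succ {R : Type*} [CommRing R] (m n : ℕ) :
    (Polynomial.Chebyshev.S R (m : ℤ)).resultant (Polynomial.Chebyshev.S R ((n + m + 1 : ℕ) : ℤ)) m (n + m + 1) =
      (-1) ^ (m * (m + 1) / 2) * (Polynomial.Chebyshev.S R (m : ℤ)).resultant (Polynomial.Chebyshev.S R (n : ℤ)) m n := by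
  nontriviality R
  have hadd : Polynomial.Chebyshev.S R ((n + m + 1 : ℕ) : ℤ) =
      Polynomial.Chebyshev.S R (n : ℤ) * Polynomial.Chebyshev.S R ((m + 1 : ℕ) : ℤ) + Polynomial.Chebyshev.S R (m : ℤ) * (-Polynomial.Chebyshev.S R ((n : ℤ) - 1)) := by
    have h := chebyshevS_add (R := R) (n : ℤ) ((m + 1 : ℕ) : ℤ)
    rw [show (n : ℤ) + ((m + 1 : ℕ) : ℤ) = ((n + m + 1 : ℕ) : ℤ) by push_cast; ring, show ((m + 1 : ℕ) : ℤ) - 1 = (m : ℤ) by push_cast; ring] at h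
    rw [h]; ring
  have hdm : (Polynomial.Chebyshev.S R (m : ℤ)).natDegree ≤ m := (chebyshevS_natDegree_monic (R := R) m).1.le
  have hdp : (-Polynomial.Chebyshev.S R ((n : ℤ) - 1)).natDegree + m ≤ n + m + 1 := by
    rw [natDegree_neg]; have := chebyshevS_natDegree_pred_le (R := R) n; omega
  have hN : n + m + 1 = (Polynomial.Chebyshev.S R (n : ℤ)).natDegree + (Polynomial.Chebyshev.S R ((m + 1 : ℕ) : ℤ)).natDegree := by
    rw [(chebyshevS_natDegree_monic (R := R) n).1, (chebyshevS_natDegree_monic (R := R) (m + 1)).1]; ring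
  have hcons : (Polynomial.Chebyshev.S R (m : ℤ)).resultant (Polynomial.Chebyshev.S R ((m + 1 : ℕ) : ℤ)) m (m + 1) = (-1) ^ (m * (m + 1) / 2) := by
    rw [Polynomial.resultant_comm, Even.neg_one_pow (Nat.even_mul_succ_self m), one_mul, chebyshevS_resultant_succ]
  rw [hadd, Polynomial.resultant_add_mul_right _ _ _ _ _ hdp hdm, hN, Polynomial.resultant_mul_right _ _ _ _ hdm, (chebyshevS_natDegree_monic (R := R) n).1,
    (chebyshevS_natDegree_monic (R := R) (m + 1)).1, hcons]
  ring

/-- The descent step for the closed form. [this file, §1233] -/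
theorem chebyshevS_resultant_closed_step {R : Type*} [CommRing R] {m k : ℕ}
    (h : (Polynomial.Chebyshev.S R (m : ℤ)).resultant (Polynomial.Chebyshev.S R (k : ℤ)) m k = if Nat.Coprime (m + 1) (k + 1) then (-1) ^ (m * k / 2) else 0) :
    (Polynomial.Chebyshev.S R (m : ℤ)).resultant (Polynomial.Chebyshev.S R ((k + m + 1 : ℕ) : ℤ)) m (k + m + 1) =
      if Nat.Coprime (m + 1) (k + m + 1 + 1) then (-1) ^ (m * (k + m + 1) / 2) else 0 := by
  rw [chebyshevS_resultant_add_succ, h]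
  have hiff : Nat.Coprime (m + 1) (k + m + 1 + 1) ↔ Nat.Coprime (m + 1) (k + 1) := by
    rw [show k + m + 1 + 1 = (k + 1) + (m + 1) by ring, Nat.coprime_add_self_right]
  by_cases hc : Nat.Coprime (m + 1) (k + 1)
  · rw [if_pos hc, if_pos (hiff.2 hc), show m * (k + m + 1) = m * k + m * (m + 1) by ring,
      Nat.add_div_of_dvd_right (even_iff_two_dvd.1 (even_mul_of_coprime_succ hc)), pow_add]
    ring
  · rw [if_neg hc, if_neg (fun h' => hc (hiff.1 h')), mul_zero]

/-- **`Res_{(m,n)}(S_m, S_n) = (−1)^{mn∕2}` if `gcd(m+1, n+1) = 1` and `= 0` otherwise, for all `m, n ∈ ℕ` and EVERY commutative ring** (the resultant of two Vieta–Fibonacci ∕ rescaled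
second-kind Chebyshev polynomials is unimodular or zero). [Dilcher–Stolarsky 2005 Thm 3.1 (monic form); this file, §1233] -/
theorem chebyshevS_resultant_closed {R : Type*} [CommRing R] (m n : ℕ) :
    (Polynomial.Chebyshev.S R (m : ℤ)).resultant (Polynomial.Chebyshev.S R (n : ℤ)) m n = if Nat.Coprime (m + 1) (n + 1) then (-1) ^ (m * n / 2) else 0 := by
  nontriviality R
  obtain ⟨s, hs⟩ : ∃ s, m + n = s := ⟨_, rfl⟩
  induction s using Nat.strong_induction_on generalizing m n with
  | _ s ih =>
  rcases lt_trichotomy m n with hlt | rfl | hgt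
  · obtain ⟨k, rfl⟩ : ∃ k, n = k + m + 1 := ⟨n - m - 1, by omega⟩
    exact chebyshevS_resultant_closed_step (ih (m + k) (by omega) m k rfl)
  · rcases Nat.eq_zero_or_pos m with rfl | hm
    · rw [Nat.cast_zero, Polynomial.Chebyshev.S_zero]
      simp
    · have h0 := Polynomial.resultant_self_eq_zero (Polynomial.Chebyshev.S R (m : ℤ)) (by rw [(chebyshevS_natDegree_monic (R := R) m).1]; omega)
      rw [(chebyshevS_natDegree_monic (R := R) m).1] at h0
      rw [h0, if_neg (by rw [Nat.coprime_self]; omega)]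
  · obtain ⟨k, rfl⟩ : ∃ k, m = k + n + 1 := ⟨m - n - 1, by omega⟩
    rw [Polynomial.resultant_comm, chebyshevS_resultant_closed_step (ih (n + k) (by omega) n k rfl)]
    by_cases hc : Nat.Coprime (k + n + 1 + 1) (n + 1)
    · rw [if_pos hc, if_pos (Nat.coprime_comm.1 hc), mul_comm n (k + n + 1), Even.neg_one_pow (even_mul_of_coprime_succ hc), one_mul]
    · rw [if_neg hc, if_neg (fun h' => hc (Nat.coprime_comm.1 h')), mul_zero]

end Summit.Ventures.HSemireg.Wedge.HankelOuter
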